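import Literature.NumberTheory.EllipticCurves.SqrtTwoTwistHeckeCoefficients
import Literature.NumberTheory.LFunctions.BinaryThetaSeries
import Literature.NumberTheory.EllipticCurves.AnalyticRank
import HarnessLib

/-!
# `L(B_n ⊗ c, s) = Θ-L(Ψ_{n,c}, s)`: the `L`-series of `y² = x³ + 4n x² + 2n² x` as a weight-one theta `L`-series of `ℤ[√-2]`,
# and `L(B_n, s)` is entire — modulo Brewer's character sum

Topic `Literature/NumberTheory/EllipticCurves`, namespace `Literature.NumberTheory.EllipticCurves.SqrtTwoTwist` (sequel to
`SqrtTwoTwistHeckeCoefficients`).  THEOREMS ONLY (no definition, no named fact).  The `ℤ[√-2]`-twin of `QuarticTwistThetaDictionary` /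
`QuarticTwistEntireLFunction` (`ℤ[i]`) and `SexticTwistThetaDictionary` / `SexticTwistEntireLFunction` (`ℤ[ω]`): Deuring's
«`L(E, s) = L(s, ψ)`» for the CM curves `B_n : y² = x³ + 4n x² + 2n² x` (`n` odd, square-free; `j = 8000`, CM by `ℤ[√-2]`;
Rajwade 1968) with Hecke's continuation of weight-one binary theta series (Hecke 1920 §9; the tree's
`LFunctions.BinaryTheta.thetaLFunction` for the form `y₁² + 2y₂²`).

The coefficient.  For `c : ℤ/m₀ → ℂ` put `Ψ(y) = 𝟙[y₁ + y₂√-2 primary] · (−n / Q(y)) · c(Q(y))`, `Q(y) = y₁² + 2y₂²` (Rajwade's primary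
classes `1, 3, 1 ± √-2, 3 ± √-2, 5 + 2√-2, 7 + 2√-2 (mod 4√-2)` of `SqrtNegTwoPrimary`; `(−n/·)` the Jacobi symbol).  Then:

* `thetaWeight_periodic` — `Ψ` is periodic modulo `8|n|m₀` in both variables;
* `coeff_thetaWeight` — **`Σ_{Q(y) = m} Ψ(y) y₁ = c(m) a_m(B_n)`** (`lFunction_eq_jacobiSym_mul_primarySum`: `a_m = (−n/m) Σ_{x primary} x`,
  real parts);
* `lSeries_twist_eq_thetaLFunction` — **`Σ_m c(m) a_m(B_n) m^{−s} = thetaLFunction 2 (8|n|m₀) 1 0 Ψ s`** for `Re s > 3/2`, whence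
  `exists_differentiable_twist` and
* ★ `hasEntireLFunction_of_brewer` — **`(⟨0, 4n, 0, 2n², 0⟩ : WeierstrassCurve ℚ).HasEntireLFunction`** for every odd square-free `n`,
  MODULO Brewer's theorem `Brewer1961_characterSum` (the sign of `a_p` at the split primes; `SqrtTwoTwistBrewer`).

This discharges the Deuring–Hecke continuation leaf `hasEntireLFunction_of_j_mem_maximalCMJInvariants` on the curves `B_n`
(`j = 8000`) of the BSD programme's `√-2` corner, conditionally on one printed character-sum evaluation (Brewer 1961 /
Leonard–Williams 1975) instead of the theory of complex multiplication.  Nothing about BSD is proved here.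

## References
* A. R. Rajwade, *Arithmetic on curves with complex multiplication by √−2*, Proc. Cambridge Philos. Soc. 64 (1968), Thm. 1 and §5
  (the `L`-series). [Rajwade1968]
* E. Hecke, *Eine neue Art von Zetafunktionen …* II, Math. Z. 6 (1920), §9. [Hecke1920]
* K. Ireland, M. Rosen, *A Classical Introduction to Modern Number Theory*, 2nd ed., Ch. 18 §5 Thm. 6, §6 Thm. 7 (the model).
  [IrelandRosen1990]
* J. H. Silverman, *The Arithmetic of Elliptic Curves*, 2nd ed. (2009), App. C §16 (`HasEntireLFunction`). [SilvermanAEC2009]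

## Mathlib / tree search
Tree: `BinaryTheta.{qf, qfEq, mem_qfEq, wt, coeff, coeff_zero, thetaLFunction, thetaLFunction_eq_LSeries, differentiable_thetaLFunction}`
(`LFunctions/BinaryThetaSeries`), `SqrtTwoTwist.lFunction_eq_jacobiSym_mul_primarySum` (`SqrtTwoTwistHeckeCoefficients`),
`SqrtNegTwoPrimary.{IsPrimary, primaryRes, primaryNormEq, mem_primaryNormEq, primarySum, IsPrimary.norm_odd}`,
`WeierstrassCurve.HasEntireLFunction` (`AnalyticRank`).  Mathlib: `LSeries`, `LSeries_congr`, `jacobiSym.mod_right`, `Finset.sum_bij'`.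
-/

noncomputable section

open scoped Classical

namespace Literature.NumberTheory.EllipticCurves

namespace SqrtTwoTwist

open _root_.WeierstrassCurve Complex Literature.NumberTheory.LFunctions
open Literature.NumberTheory.QuadraticFields Literature.NumberTheory.QuadraticFields.SqrtNegTwoPrimary

variable {n : ℤ} {m₀ : ℕ}

/-! ### §1 The theta coefficient `Ψ` and its period `8|n|m₀` -/

/-- `Q(y + Mz) = Q(y) + M·t`: the form `y₁² + 2y₂²` modulo `M`. [cite: Hecke1920, §9] -/
private theorem qf_add_mul (M : ℕ) (y z : ℤ × ℤ) :
    BinaryTheta.qf 2 (y.1 + M * z.1, y.2 + M * z.2) =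
      BinaryTheta.qf 2 y + M * (2 * y.1 * z.1 + M * z.1 ^ 2 + 4 * y.2 * z.2 + 2 * M * z.2 ^ 2) := by
  simp only [BinaryTheta.qf]; push_cast; ring

/-- Primarity of `y₁ + y₂√-2` only depends on `(y₁, y₂) mod 8`. [cite: Silverberg2010, Thm. 2.7] -/
private theorem isPrimary_add_mul {M : ℕ} (hM : 8 ∣ M) (y z : ℤ × ℤ) :
    IsPrimary (⟨y.1 + M * z.1, y.2 + M * z.2⟩ : ℤ√(-2)) ↔ IsPrimary (⟨y.1, y.2⟩ : ℤ√(-2)) := by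
  have hM8 : ((M : ℤ) : ZMod 8) = 0 := (ZMod.intCast_zmod_eq_zero_iff_dvd (M : ℤ) 8).mpr (by exact_mod_cast hM)
  unfold IsPrimary
  simp only [Int.cast_add, Int.cast_mul, hM8, zero_mul, add_zero]

/-- **`Ψ` is periodic modulo `8|n|m₀`** in both variables: primarity is a condition mod `8`, `Q(y + Mz) ≡ Q(y) (mod M)`, the Jacobi
symbol `(−n/q)` only depends on the odd number `q` modulo `4|n|` (`jacobiSym.mod_right`), and `c` on `Q mod m₀`.
[cite: Hecke1920, §9] [cite: Rajwade1968, §5] -/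
theorem thetaWeight_periodic (m₀ : ℕ) (c : ZMod m₀ → ℂ) {Ψ : ℤ × ℤ → ℂ}
    (hΨ : ∀ y, Ψ y = if IsPrimary (⟨y.1, y.2⟩ : ℤ√(-2)) then
      (jacobiSym (-n) (BinaryTheta.qf 2 y).toNat : ℂ) * c ((BinaryTheta.qf 2 y : ℤ) : ZMod m₀) else 0) :
    ∀ y z : ℤ × ℤ, Ψ (y.1 + (8 * n.natAbs * m₀ : ℕ) * z.1, y.2 + (8 * n.natAbs * m₀ : ℕ) * z.2) = Ψ y := by
  intro y z
  set M : ℕ := 8 * n.natAbs * m₀ with hM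
  rw [hΨ, hΨ y]
  simp only
  have hiff := isPrimary_add_mul (M := M) ⟨n.natAbs * m₀, by rw [hM]; ring⟩ y z
  by_cases hprim : IsPrimary (⟨y.1, y.2⟩ : ℤ√(-2))
  · rw [if_pos (hiff.mpr hprim), if_pos hprim]
    -- `Q(y') = Q(y) + M t`, both odd and nonnegative
    set t : ℤ := 2 * y.1 * z.1 + M * z.1 ^ 2 + 4 * y.2 * z.2 + 2 * M * z.2 ^ 2 with ht
    have hQ : BinaryTheta.qf 2 (y.1 + (M : ℤ) * z.1, y.2 + (M : ℤ) * z.2) = BinaryTheta.qf 2 y + M * t := qf_add_mul M y z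
    have hQ0 : 0 ≤ BinaryTheta.qf 2 y := BinaryTheta.qf_nonneg 2 y
    have hQ0' : 0 ≤ BinaryTheta.qf 2 (y.1 + (M : ℤ) * z.1, y.2 + (M : ℤ) * z.2) := BinaryTheta.qf_nonneg 2 _
    -- the argument of `c`
    have hc : (((BinaryTheta.qf 2 (y.1 + (M : ℤ) * z.1, y.2 + (M : ℤ) * z.2) : ℤ)) : ZMod m₀) =
        ((BinaryTheta.qf 2 y : ℤ) : ZMod m₀) := by
      rw [hQ]
      push_cast
      have hMz : ((M : ℤ) : ZMod m₀) = 0 :=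
        (ZMod.intCast_zmod_eq_zero_iff_dvd (M : ℤ) m₀).mpr
          (Int.natCast_dvd_natCast.mpr ⟨8 * n.natAbs, by rw [hM]; ring⟩)
      have hMn : ((M : ℕ) : ZMod m₀) = 0 := by exact_mod_cast hMz
      rw [hMn, zero_mul, add_zero]
    -- the Jacobi symbol: odd arguments congruent modulo `4|n|`
    have hodd : (BinaryTheta.qf 2 y) % 2 = 1 := by
      have h1 := hprim.norm_odd
      rw [Zsqrtd.norm_def] at h1
      simp only [BinaryTheta.qf]
      push_cast
      have : y.1 ^ 2 + 2 * y.2 ^ 2 = y.1 * y.1 - -2 * y.2 * y.2 := by ring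
      rw [this]; exact h1
    set q : ℕ := (BinaryTheta.qf 2 y).toNat with hq
    set q' : ℕ := (BinaryTheta.qf 2 (y.1 + (M : ℤ) * z.1, y.2 + (M : ℤ) * z.2)).toNat with hq'
    have hqz : (q : ℤ) = BinaryTheta.qf 2 y := Int.toNat_of_nonneg hQ0
    have hq'z : (q' : ℤ) = BinaryTheta.qf 2 y + M * t := by rw [hq', Int.toNat_of_nonneg hQ0', hQ]
    have hqodd : Odd q := by
      rw [Nat.odd_iff]
      have : ((q % 2 : ℕ) : ℤ) = 1 := by rw [Int.natCast_mod, hqz]; exact_mod_cast hodd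
      exact_mod_cast this
    have hq'odd : Odd q' := by
      rw [Nat.odd_iff]
      have h2M : (2 : ℤ) ∣ (M : ℤ) * t := by
        rw [hM]
        refine ⟨4 * n.natAbs * m₀ * t, ?_⟩
        push_cast
        ring
      have : ((q' % 2 : ℕ) : ℤ) = 1 := by
        rw [Int.natCast_mod, hq'z]
        push_cast
        rw [Int.add_emod, Int.emod_eq_zero_of_dvd h2M, add_zero, Int.emod_emod_of_dvd _ (dvd_refl _), hodd]
      exact_mod_cast this
    have hmod : q' % (4 * (-n).natAbs) = q % (4 * (-n).natAbs) := by
      have h4 : ((4 * (-n).natAbs : ℕ) : ℤ) ∣ (M : ℤ) * t := by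
        rw [hM, Int.natAbs_neg]
        refine ⟨2 * m₀ * t, ?_⟩
        push_cast
        ring
      have : ((q' % (4 * (-n).natAbs) : ℕ) : ℤ) = ((q % (4 * (-n).natAbs) : ℕ) : ℤ) := by
        rw [Int.natCast_mod, Int.natCast_mod, hq'z, hqz, Int.add_emod, Int.emod_eq_zero_of_dvd h4, add_zero,
          Int.emod_emod_of_dvd _ (dvd_refl _)]
      exact_mod_cast this
    rw [hc, jacobiSym.mod_right (-n) hq'odd, jacobiSym.mod_right (-n) hqodd, hmod]
  · rw [if_neg (fun h ↦ hprim (hiff.mp h)), if_neg hprim]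

/-! ### §2 The coefficients: `Σ_{Q(y) = m} Ψ(y) y₁ = c(m) a_m(B_n)` -/

/-- `re` of a finite sum in `ℤ[√-2]`. [cite: IrelandRosen1990, Ch. 1, Ex. 36] -/
private theorem re_sum {ι : Type*} (s : Finset ι) (f : ι → ℤ√(-2)) : (∑ i ∈ s, f i).re = ∑ i ∈ s, (f i).re := by
  induction s using Finset.cons_induction with
  | empty => simp
  | cons a s ha ih => rw [Finset.sum_cons, Finset.sum_cons, Zsqrtd.re_add, ih]

/-- **`a_m(B_n) = (−n/m) · Σ_{x primary, N x = m} re(x)` in `ℤ`** (real parts in `lFunction_eq_jacobiSym_mul_primarySum`; the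
imaginary parts cancel since the primary classes are stable under conjugation). [cite: Rajwade1968, Thm. 1] -/
theorem lFunction_eq_jacobiSym_mul_sum_re (hB : Brewer1961_characterSum) (hn : Squarefree n) (hodd : Odd n)
    {m : ℕ} (hm : m ≠ 0) :
    (⟨0, 4 * (n : ℚ), 0, 2 * (n : ℚ) ^ 2, 0⟩ : WeierstrassCurve ℚ).LFunction m =
      jacobiSym (-n) m * ∑ x ∈ primaryNormEq m, x.re := by
  have h := congrArg Zsqrtd.re (lFunction_eq_jacobiSym_mul_primarySum hB hn hodd hm)
  rw [Zsqrtd.re_intCast, Zsqrtd.re_mul, Zsqrtd.re_intCast, Zsqrtd.im_intCast, primarySum, re_sum] at h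
  rw [h]; ring

/-- The primary lattice points of `Q(y) = m` correspond to the primary elements of norm `m`:
`Σ_{Q(y) = m, y primary} g(y₁, y₂) = Σ_{x primary, N x = m} g(re x, im x)`. [cite: Rajwade1968, §5] -/
private theorem sum_qfEq_filter_isPrimary {M' : Type*} [AddCommMonoid M'] (g : ℤ → ℤ → M') (m : ℕ) :
    ∑ y ∈ (BinaryTheta.qfEq 2 m).filter (fun y ↦ IsPrimary (⟨y.1, y.2⟩ : ℤ√(-2))), g y.1 y.2 =
      ∑ x ∈ primaryNormEq m, g x.re x.im := by
  refine Finset.sum_bij' (fun y _ ↦ (⟨y.1, y.2⟩ : ℤ√(-2))) (fun x _ ↦ (x.re, x.im)) ?_ ?_ (fun _ _ ↦ rfl)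
    (fun _ _ ↦ rfl) (fun _ _ ↦ rfl)
  · intro y hy
    rw [Finset.mem_filter, BinaryTheta.mem_qfEq 2] at hy
    refine mem_primaryNormEq.mpr ⟨?_, hy.2⟩
    rw [Zsqrtd.norm_def, ← hy.1, BinaryTheta.qf]; push_cast; ring
  · intro x hx
    obtain ⟨hxn, hxp⟩ := mem_primaryNormEq.mp hx
    rw [Finset.mem_filter, BinaryTheta.mem_qfEq 2]
    refine ⟨?_, hxp⟩
    rw [BinaryTheta.qf, ← hxn, Zsqrtd.norm_def]; push_cast; ring

/-- **`Σ_{Q(y) = m} Ψ(y) y₁ = c(m) a_m(B_n)`**: the `L`-series coefficients of the theta series `θ_Ψ` (weight `y₁ = re`) are the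
twisted coefficients of `L(B_n, s)` — Rajwade's `L(B_n, s) = Σ_{x primary} (−n/Nx) x Nx^{−s}`, each primary `x` counted once, real
parts (modulo Brewer's theorem `hB`; `n` odd square-free). [cite: Rajwade1968, Thm. 1 and §5] -/
theorem coeff_thetaWeight (hB : Brewer1961_characterSum) (hn : Squarefree n) (hodd : Odd n) (m₀ : ℕ) (c : ZMod m₀ → ℂ)
    {Ψ : ℤ × ℤ → ℂ}
    (hΨ : ∀ y, Ψ y = if IsPrimary (⟨y.1, y.2⟩ : ℤ√(-2)) then
      (jacobiSym (-n) (BinaryTheta.qf 2 y).toNat : ℂ) * c ((BinaryTheta.qf 2 y : ℤ) : ZMod m₀) else 0) (m : ℕ) :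
    BinaryTheta.coeff 2 1 0 Ψ m =
      c (m : ZMod m₀) * ((⟨0, 4 * (n : ℚ), 0, 2 * (n : ℚ) ^ 2, 0⟩ : WeierstrassCurve ℚ).LFunction m : ℂ) := by
  rcases eq_or_ne m 0 with rfl | hm
  · simp [ArithmeticFunction.map_zero]
  rw [BinaryTheta.coeff]
  have hterm : ∀ y ∈ BinaryTheta.qfEq 2 m, Ψ y * BinaryTheta.wt 1 0 y =
      if IsPrimary (⟨y.1, y.2⟩ : ℤ√(-2)) then (jacobiSym (-n) m : ℂ) * c (m : ZMod m₀) * (y.1 : ℂ) else 0 := by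
    intro y hy
    have hq : BinaryTheta.qf 2 y = m := (BinaryTheta.mem_qfEq 2).mp hy
    rw [hΨ, hq, Int.toNat_natCast, Int.cast_natCast, BinaryTheta.wt]
    split_ifs <;> simp
  rw [Finset.sum_congr rfl hterm, ← Finset.sum_filter]
  simp_rw [mul_assoc]
  rw [← Finset.mul_sum, ← Finset.mul_sum,
    sum_qfEq_filter_isPrimary (fun a _ ↦ ((a : ℤ) : ℂ)) m, lFunction_eq_jacobiSym_mul_sum_re hB hn hodd hm]
  push_cast
  ring

/-! ### §3 The `L`-series identity and the entire continuation -/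

/-- `8|n|m₀ ≠ 0` for `n` odd and `m₀ ≠ 0`. [cite: Rajwade1968, §5] -/
private theorem neZero_period (hodd : Odd n) (m₀ : ℕ) [NeZero m₀] : NeZero (8 * n.natAbs * m₀) := by
  refine ⟨mul_ne_zero (mul_ne_zero (by norm_num) ?_) (NeZero.ne m₀)⟩
  rw [Int.natAbs_ne_zero]
  rintro rfl
  exact Int.not_even_iff_odd.mpr hodd (by decide)

/-- **`Σ_m c(m) a_m(B_n) m^{−s} = Θ-L_{8|n|m₀}(Ψ)(s)` for `Re s > 3/2`** — Rajwade's «`L(B_n, s) = L(s, ψ)`» twisted by `c(N·)`, with the Hecke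
series realised as the tree's weight-one theta `L`-series of the form `y₁² + 2y₂²` with the periodic coefficient `Ψ` and weight `y₁`
(modulo Brewer's theorem `hB`; `n` odd square-free). [cite: Rajwade1968, Thm. 1 and §5] [cite: Hecke1920, §9] -/
theorem lSeries_twist_eq_thetaLFunction (hB : Brewer1961_characterSum) (hn : Squarefree n) (hodd : Odd n) (m₀ : ℕ) [NeZero m₀]
    (c : ZMod m₀ → ℂ) {Ψ : ℤ × ℤ → ℂ}
    (hΨ : ∀ y, Ψ y = if IsPrimary (⟨y.1, y.2⟩ : ℤ√(-2)) then
      (jacobiSym (-n) (BinaryTheta.qf 2 y).toNat : ℂ) * c ((BinaryTheta.qf 2 y : ℤ) : ZMod m₀) else 0)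
    {s : ℂ} (hs : 3 / 2 < s.re) :
    haveI := neZero_period hodd m₀
    LSeries (fun m : ℕ ↦ c (m : ZMod m₀) * ((⟨0, 4 * (n : ℚ), 0, 2 * (n : ℚ) ^ 2, 0⟩ : WeierstrassCurve ℚ).LFunction m : ℂ)) s =
      BinaryTheta.thetaLFunction 2 (8 * n.natAbs * m₀) 1 0 Ψ s := by
  haveI := neZero_period hodd m₀
  rw [BinaryTheta.thetaLFunction_eq_LSeries 2 (8 * n.natAbs * m₀) 1 0 Ψ (thetaWeight_periodic m₀ c hΨ) hs]
  exact LSeries_congr (fun {m} _ ↦ (coeff_thetaWeight hB hn hodd m₀ c hΨ m).symm) s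

/-- **Hecke's continuation for `L(B_n ⊗ c, s)`**: `Σ_m c(m) a_m(B_n) m^{−s}` is the restriction to `Re s > 3/2` of an entire function
(the theta `L`-function), modulo Brewer's theorem; `n` odd square-free, any `c : ℤ/m₀ → ℂ`.
[cite: Rajwade1968, Thm. 1 and §5] [cite: Hecke1920, §9] -/
theorem exists_differentiable_twist (hB : Brewer1961_characterSum) (hn : Squarefree n) (hodd : Odd n) (m₀ : ℕ) [NeZero m₀]
    (c : ZMod m₀ → ℂ) :
    ∃ L : ℂ → ℂ, Differentiable ℂ L ∧ ∀ s : ℂ, 3 / 2 < s.re →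
      L s = LSeries (fun m : ℕ ↦ c (m : ZMod m₀) * ((⟨0, 4 * (n : ℚ), 0, 2 * (n : ℚ) ^ 2, 0⟩ : WeierstrassCurve ℚ).LFunction m : ℂ)) s := by
  haveI := neZero_period hodd m₀
  set Ψ : ℤ × ℤ → ℂ := fun y ↦ if IsPrimary (⟨y.1, y.2⟩ : ℤ√(-2)) then
      (jacobiSym (-n) (BinaryTheta.qf 2 y).toNat : ℂ) * c ((BinaryTheta.qf 2 y : ℤ) : ZMod m₀) else 0
  refine ⟨BinaryTheta.thetaLFunction 2 (8 * n.natAbs * m₀) 1 0 Ψ, BinaryTheta.differentiable_thetaLFunction _ _ _ _ _,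
    fun s hs ↦ ?_⟩
  exact (lSeries_twist_eq_thetaLFunction hB hn hodd m₀ c (Ψ := Ψ) (fun _ ↦ rfl) hs).symm

/-- ★ **`L(B_n, s)` is entire for every odd square-free `n`, modulo Brewer's character sum**: the Weierstrass curve
`⟨0, 4n, 0, 2n², 0⟩ : y² = x³ + 4n x² + 2n² x` over `ℚ` (CM by `ℤ[√-2]`, `j = 8000`) satisfies the BSD prelude's
`WeierstrassCurve.HasEntireLFunction` (`W.LSeries` has an entire continuation from `Re s > 3/2`) — the untwisted case `m₀ = 1`, `c = 1`
of the dictionary.  This is the Deuring–Hecke continuation leaf `hasEntireLFunction_of_j_mem_maximalCMJInvariants` on this family,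
conditionally on `Brewer1961_characterSum` (Brewer 1961 / Leonard–Williams 1975) instead of the theory of complex multiplication.
[cite: Rajwade1968, Thm. 1 and §5] [cite: Hecke1920, §9] [cite: SilvermanAEC2009, App. C §16] -/
theorem hasEntireLFunction_of_brewer (hB : Brewer1961_characterSum) (hn : Squarefree n) (hodd : Odd n) :
    (⟨0, 4 * (n : ℚ), 0, 2 * (n : ℚ) ^ 2, 0⟩ : WeierstrassCurve ℚ).HasEntireLFunction := by
  obtain ⟨L, hL, hLs⟩ := exists_differentiable_twist hB hn hodd 1 (fun _ ↦ (1 : ℂ))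
  refine ⟨L, hL, fun s hs ↦ ?_⟩
  rw [hLs s hs, WeierstrassCurve.LSeries]
  exact LSeries_congr (fun {m} _ ↦ by simp) s

end SqrtTwoTwist

end Literature.NumberTheory.EllipticCurves

end
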